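import Summits.QuantumFields.YangMills.Theorems.VirialFluxGapTwistedEquipartitionGlue
import Summits.QuantumFields.YangMills.Theorems.VirialFluxGapConvexTransport
import Summits.QuantumFields.YangMills.Theorems.VirialFluxGapLogSectorWeightConvex
import HarnessLib

/-!
# Route `VirialFluxGap` / `SwapVirialDeficit` (YangMills): TWO-SIDED twisted equipartition from the sharp twisted Laplace law

The convex transport (✓`ConvexTransport.convexTransport_proof`, item 24181) is two-sided: `|b·g′(b) + D/2| ≤ 8√(ηD)`.  The landed glue
✓`TwistedEquipartitionGlue.twistedEquipartitionGlue_proof` (item 24183) used its upper half.  This file records BOTH halves: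
`SharpTwistedLaplace → ∀ ε > 0, on Laplace windows, |β·(log W_z)′(β) − (12βL⁴ − 9L⁴)| ≤ ε` for every twisted sector `z ≠ 0`
(`twoSided_of_sharpTwistedLaplace`), hence

* `twistedEquipartitionLower_of_sharpTwistedLaplace : SharpTwistedLaplace → TwistedEquipartitionLower` — the Prop of stub
  `stub_twistedEquipartitionLower` of LINE «sector-mixture» on crux `SwapVirialDeficit.ToronSoftnessSharp` (stmt-QuantumFields-24196;
  planner ym-idea-4 g14, HOME bc/g14-B/mix/ToronSoftnessSharp_mixture_birth.lean) restated verbatim as the conclusion, so that stub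
  closes by `exact twistedEquipartitionLower_of_sharpTwistedLaplace h` once the crux `SharpTwistedLaplace` (24204) is proved;
* `twistedEquipartition_of_sharpTwistedLaplace : SharpTwistedLaplace → TwistedEquipartition` (the upper half, with the two landed
  supports discharged).

HONEST FRAMING: conditional bookkeeping on the OPEN crux `SharpTwistedLaplace` (24204); nothing here proves 24204, 24196, 24142 or the
leaf; no rung / summit statement is proved; the Yang–Mills mass gap is NOT proved.  THEOREMS ONLY (0 `def`, 0 `sorry`), standard axioms.
References: [cite: Griffiths1964]; [cite: TomboulisYaffe1985].
-/

set_option autoImplicit false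

noncomputable section

open Set
open Summit.QuantumFields.YangMills.Theorems.FemtoTransferGap.TT.SectorSmooth
  (differentiable_sectorWeight_one sectorWeight_one_pos)
open Summit.QuantumFields.YangMills.Theorems.VirialFluxGap.TwistedEquipartitionGlue
  (rpow_half_le_rpow_of_window window_decay)

namespace Summit.QuantumFields.YangMills.Theorems.VirialFluxGap.TwistedEquipartitionTwoSided

/-- ★★ **Two-sided twisted equipartition from the sharp twisted Laplace law**: for every `ε > 0`, on Laplace windows `L ≤ β^{a′}`,
`|β·(log W_z)′(β) − (12βL⁴ − 9L⁴)| ≤ ε` for every `z ≠ 0`. [cite: Griffiths1964] -/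
theorem twoSided_of_sharpTwistedLaplace
    (hSharp : Summit.QuantumFields.YangMills.Theses.VirialFluxGap.SharpTwistedLaplace) :
    ∀ ε : ℝ, 0 < ε → ∃ a : ℝ, 0 < a ∧ ∃ β₀ : ℝ, ∃ L₀ : ℕ, ∀ β : ℝ, β₀ ≤ β → ∀ (L : ℕ) [NeZero L], L₀ ≤ L →
      (L : ℝ) ≤ β ^ a → ∀ z : Fin 3 → Bool, z ≠ (fun _ => false) →
        |β * deriv (fun b : ℝ => Real.log
            (Summit.QuantumFields.YangMills.Theorems.FemtoTransferGap.TT.sectorWeight (L := L) b (2 * L - 1) z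
              (fun _ _ => (1 : ℝ)))) β - (12 * β * (L : ℝ) ^ 4 - 9 * (L : ℝ) ^ 4)| ≤ ε := by
  have hCT := Summit.QuantumFields.YangMills.Theorems.VirialFluxGap.ConvexTransport.convexTransport_proof
  have hConv := Summit.QuantumFields.YangMills.Theorems.virialFluxGap_logSectorWeightConvex_proof
  intro ε hε
  obtain ⟨K, q, C, a, ha, β₁, L₁, hSharp⟩ := hSharp
  -- constants (as in the landed glue)
  set K' : ℝ := max K 0 with hK'
  have hK'0 : 0 ≤ K' := le_max_right _ _
  have hKK' : K ≤ K' := le_max_left _ _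
  set Q : ℝ := |q| + 4 with hQ
  have hQ0 : 0 < Q := by rw [hQ]; positivity
  set a' : ℝ := min (a / 2) (1 / (2 * Q)) with ha'
  have ha'0 : 0 < a' := lt_min (by linarith) (by positivity)
  have ha'a : a' ≤ a / 2 := min_le_left _ _
  have ha'Q : a' * (|q| + 4) ≤ 1 / 2 := by
    have h : a' ≤ 1 / (2 * Q) := min_le_right _ _
    rw [← hQ]
    calc a' * Q ≤ 1 / (2 * Q) * Q := mul_le_mul_of_nonneg_right h hQ0.le
      _ = 1 / 2 := by field_simp
  set τ : ℝ := min ((ε / 8) ^ 2) 324 with hτ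
  have hτ0 : 0 < τ := lt_min (by positivity) (by norm_num)
  have hτε : τ ≤ (ε / 8) ^ 2 := min_le_left _ _
  have hτ324 : τ ≤ 324 := min_le_right _ _
  set M : ℝ := (36 * K' + 1) / τ with hM
  have hM0 : 0 < M := div_pos (by linarith) hτ0
  refine ⟨a', ha'0, max (max 4 (2 * β₁)) (M ^ 2), L₁, ?_⟩
  intro β hβ L _ hL hLa z hz
  have hβ4 : 4 ≤ β := le_trans (le_trans (le_max_left _ _) (le_max_left _ _)) hβ
  have hββ₁ : 2 * β₁ ≤ β := le_trans (le_trans (le_max_right _ _) (le_max_left _ _)) hβ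
  have hβM : M ^ 2 ≤ β := le_trans (le_max_right _ _) hβ
  have hβ1 : 1 ≤ β := by linarith
  have hβ0 : 0 < β := by linarith
  have hL1 : (1 : ℝ) ≤ (L : ℝ) := Nat.one_le_cast.mpr (NeZero.one_le)
  have hL0 : (0 : ℝ) < (L : ℝ) := by linarith
  set W : ℝ → ℝ := fun b : ℝ =>
    Summit.QuantumFields.YangMills.Theorems.FemtoTransferGap.TT.sectorWeight (L := L) b (2 * L - 1) z
      (fun _ _ => (1 : ℝ)) with hW
  set D : ℝ := 18 * (L : ℝ) ^ 4 with hD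
  have hD18 : 18 ≤ D := by
    have : (1 : ℝ) ≤ (L : ℝ) ^ 4 := one_le_pow₀ hL1
    rw [hD]; linarith
  have hD0 : 0 < D := by linarith
  set η : ℝ := 2 * K' * (L : ℝ) ^ q / β with hη
  have hLq0 : 0 < (L : ℝ) ^ q := Real.rpow_pos_of_pos hL0 q
  have hη0 : 0 ≤ η := by rw [hη]; positivity
  -- `η D ≤ τ`
  have hdecay := window_decay (q := q) hβ1 hL1 hLa ha'Q
  have hsqrtM : M ≤ Real.sqrt β := by
    rw [show M = Real.sqrt (M ^ 2) by rw [Real.sqrt_sq hM0.le]]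
    exact Real.sqrt_le_sqrt hβM
  have hsqrt0 : 0 < Real.sqrt β := Real.sqrt_pos.mpr hβ0
  have hrpow : β ^ (-(1 / 2 : ℝ)) = (Real.sqrt β)⁻¹ := by
    rw [Real.rpow_neg hβ0.le, Real.sqrt_eq_rpow]
  have hinv : (Real.sqrt β)⁻¹ ≤ τ / (36 * K' + 1) := by
    rw [inv_le_comm₀ hsqrt0 (div_pos hτ0 (by linarith))]
    calc (τ / (36 * K' + 1))⁻¹ = M := by rw [hM, inv_div]
      _ ≤ Real.sqrt β := hsqrtM
  have hηD : η * D ≤ τ := by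
    have h1 : η * D = 36 * K' * ((L : ℝ) ^ q * (L : ℝ) ^ 4 / β) := by
      rw [hη, hD]; ring
    rw [h1]
    calc 36 * K' * ((L : ℝ) ^ q * (L : ℝ) ^ 4 / β) ≤ 36 * K' * (Real.sqrt β)⁻¹ := by
          rw [← hrpow]; exact mul_le_mul_of_nonneg_left hdecay (by positivity)
      _ ≤ 36 * K' * (τ / (36 * K' + 1)) := mul_le_mul_of_nonneg_left hinv (by positivity)
      _ ≤ τ := by
          rw [mul_div_assoc']
          rw [div_le_iff₀ (by linarith)]
          nlinarith
  have hηleD : η ≤ D := by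
    have h : η * D ≤ D * D := by nlinarith
    exact le_of_mul_le_mul_right h hD0
  -- the convex function `g = log W − 12 L⁴ x`
  set g : ℝ → ℝ := fun x => Real.log (W x) - 12 * (L : ℝ) ^ 4 * x with hg
  have hWdiff : Differentiable ℝ W := differentiable_sectorWeight_one (L := L) (2 * L - 1) z
  have hWpos : ∀ x, 0 < W x := fun x => sectorWeight_one_pos (L := L) x (2 * L - 1) z
  have hlogW : ∀ x, DifferentiableAt ℝ (fun y => Real.log (W y)) x := fun x =>
    ((hWdiff x).log (hWpos x).ne')
  have hlin : ∀ x, HasDerivAt (fun y : ℝ => 12 * (L : ℝ) ^ 4 * y) (12 * (L : ℝ) ^ 4) x := fun x => by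
    simpa using (hasDerivAt_id x).const_mul (12 * (L : ℝ) ^ 4)
  have hgderiv : HasDerivAt g (deriv (fun y => Real.log (W y)) β - 12 * (L : ℝ) ^ 4) β :=
    (hlogW β).hasDerivAt.sub (hlin β)
  have hgdiff : DifferentiableAt ℝ g β := hgderiv.differentiableAt
  have hgconv : ConvexOn ℝ (Icc (β / 2) (2 * β)) g := by
    have h1 : ConvexOn ℝ univ (fun y => Real.log (W y)) := hConv L (2 * L - 1) z
    have h2 : ConcaveOn ℝ univ (fun y : ℝ => 12 * (L : ℝ) ^ 4 * y) := by
      have := (concaveOn_id (𝕜 := ℝ) (convex_univ (E := ℝ))).smul (show (0 : ℝ) ≤ 12 * (L : ℝ) ^ 4 by positivity)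
      simpa using this
    exact (h1.sub h2).subset (subset_univ _) (convex_Icc _ _)
  have happrox : ∀ x ∈ Icc (β / 2) (2 * β), |g x + D / 2 * Real.log x - C L z| ≤ η := by
    intro x hx
    have hxβ : β / 2 ≤ x := hx.1
    have hx0 : 0 < x := by linarith
    have hxβ₁ : β₁ ≤ x := by linarith
    have hxa : (L : ℝ) ≤ x ^ a := by
      calc (L : ℝ) ≤ β ^ a' := hLa
        _ ≤ β ^ (a / 2) := Real.rpow_le_rpow_of_exponent_le hβ1 ha'a
        _ ≤ x ^ a := rpow_half_le_rpow_of_window hβ4 ha.le hxβ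
    have h := hSharp x hxβ₁ L hL hxa z hz
    have hrw : g x + D / 2 * Real.log x - C L z =
        Real.log (W x) - (12 * x * (L : ℝ) ^ 4 - 9 * (L : ℝ) ^ 4 * Real.log x + C L z) := by
      rw [hg, hD]; ring
    rw [hrw]
    calc |Real.log (W x) - (12 * x * (L : ℝ) ^ 4 - 9 * (L : ℝ) ^ 4 * Real.log x + C L z)|
        ≤ K * (L : ℝ) ^ q / x := h
      _ ≤ K' * (L : ℝ) ^ q / x :=
          div_le_div_of_nonneg_right (mul_le_mul_of_nonneg_right hKK' hLq0.le) hx0.le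
      _ ≤ K' * (L : ℝ) ^ q / (β / 2) :=
          div_le_div_of_nonneg_left (by positivity) (by linarith) hxβ
      _ = η := by rw [hη]; field_simp
  have hct := hCT g D (C L z) η β hβ0 hD0 hη0 hηleD hgconv hgdiff happrox
  have hsqrt : 8 * Real.sqrt (η * D) ≤ ε := by
    have h1 : Real.sqrt (η * D) ≤ Real.sqrt ((ε / 8) ^ 2) := Real.sqrt_le_sqrt (hηD.trans hτε)
    rw [Real.sqrt_sq (by positivity)] at h1
    linarith
  have hderiv : deriv g β = deriv (fun y => Real.log (W y)) β - 12 * (L : ℝ) ^ 4 := hgderiv.deriv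
  rw [hderiv] at hct
  -- `β (log W)′ − (12βL⁴ − 9L⁴) = β g′(β) + D/2`
  have hrw : β * deriv (fun y => Real.log (W y)) β - (12 * β * (L : ℝ) ^ 4 - 9 * (L : ℝ) ^ 4) =
      β * (deriv (fun y => Real.log (W y)) β - 12 * (L : ℝ) ^ 4) + D / 2 := by
    rw [hD]; ring
  rw [hrw]
  exact hct.trans hsqrt

/-- ★★ **`SharpTwistedLaplace → TwistedEquipartitionLower`** (conclusion = the Prop of stub `stub_twistedEquipartitionLower` of
LINE «sector-mixture» on crux stmt-QuantumFields-24196, verbatim): the LOWER half of twisted equipartition,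
`12βL⁴ − 9L⁴ − ε ≤ β·(log W_z)′(β)` on Laplace windows, for `z ≠ 0`.  Conditional on the open crux 24204. [cite: Griffiths1964] -/
theorem twistedEquipartitionLower_of_sharpTwistedLaplace
    (hSharp : Summit.QuantumFields.YangMills.Theses.VirialFluxGap.SharpTwistedLaplace) :
    ∀ ε : ℝ, 0 < ε → ∃ a : ℝ, 0 < a ∧ ∃ β₀ : ℝ, ∃ L₀ : ℕ, ∀ β : ℝ, β₀ ≤ β → ∀ (L : ℕ) [NeZero L], L₀ ≤ L →
      (L : ℝ) ≤ β ^ a → ∀ z : Fin 3 → Bool, z ≠ (fun _ => false) →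
        12 * β * (L : ℝ) ^ 4 - 9 * (L : ℝ) ^ 4 - ε ≤
          β * deriv (fun b : ℝ => Real.log
            (Summit.QuantumFields.YangMills.Theorems.FemtoTransferGap.TT.sectorWeight (L := L) b (2 * L - 1) z
              (fun _ _ => (1 : ℝ)))) β := by
  intro ε hε
  obtain ⟨a, ha, β₀, L₀, h⟩ := twoSided_of_sharpTwistedLaplace hSharp ε hε
  refine ⟨a, ha, β₀, L₀, fun β hβ L _ hL hLa z hz => ?_⟩
  have h' := (abs_le.mp (h β hβ L hL hLa z hz)).1
  linarith

/-- ★ **`SharpTwistedLaplace → TwistedEquipartition`** (the upper half; the landed glue 24183 with its two landed supports 24181/24182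
discharged). Conditional on the open crux 24204. [cite: Griffiths1964] -/
theorem twistedEquipartition_of_sharpTwistedLaplace
    (hSharp : Summit.QuantumFields.YangMills.Theses.VirialFluxGap.SharpTwistedLaplace) :
    Summit.QuantumFields.YangMills.Theses.VirialFluxGap.TwistedEquipartition :=
  Summit.QuantumFields.YangMills.Theorems.VirialFluxGap.TwistedEquipartitionGlue.twistedEquipartitionGlue_proof hSharp
    Summit.QuantumFields.YangMills.Theorems.VirialFluxGap.ConvexTransport.convexTransport_proof
    Summit.QuantumFields.YangMills.Theorems.virialFluxGap_logSectorWeightConvex_proof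

end Summit.QuantumFields.YangMills.Theorems.VirialFluxGap.TwistedEquipartitionTwoSided

end
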